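import Summits.KontsevichZagierPeriods.KontsevichZagierPeriods.Theses.StandardParts
import Summits.KontsevichZagierPeriods.KontsevichZagierPeriods.Theorems.ReducedPeriodRing.Negative.PositiveCone
import Literature.NumberTheory.Transcendental.KZDominatedFamilyRelations

/-!
# Route StandardParts — `SpAeCongruence`: a.e.-equal extended integrands give KZ-equivalent
representations

Problem `KontsevichZagierPeriods`, route `StandardParts`, support item
stmt-KontsevichZagierPeriods-3156 (`SpAeCongruence`): two integral representations `r = [σ, f]`,
`r' = [σ', f']` of the same dimension whose integrands extended by zero agree Lebesgue-almost
everywhere, `1_σ f = 1_{σ'} f'` a.e., are `KZ.Equivalent`.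

Proof (moves (1a), (1b) of the Kontsevich–Zagier calculus only, plus Tarski–Seidenberg for the
semialgebraicity of level sets).
1. *Zero part.* For any representation, `σ = P ∪ Z` with `P = {x ∈ σ | f x ≠ 0}` and
   `Z = {x ∈ σ | f x = 0}` both `ℚ`-semialgebraic (Tarski–Seidenberg; the tree's
   `ReducedPeriodRingNegative.isSemialgebraic_sep_integrand_ne_zero/…_eq_zero`,
   `Theorems/ReducedPeriodRing/Negative/PositiveCone.lean`) and disjoint; domain additivity gives `[σ, f] − [P, f] − [Z, f] ∈ domainAddRel`, and
   `[Z, f]` is a relation because its integrand vanishes on its domain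
   (`KZ.of_mem_relations_of_eqOn_zero`). Hence `[σ, f] ≡ [P, f]`.
2. *Supports agree up to null sets.* With `E = {x ∈ P ∩ P' | f x = f' x}` (`ℚ`-semialgebraic by
   `isSemialgebraic_sep_eq`), the a.e. hypothesis makes `P ∖ E` and `P' ∖ E` null: at a point of
   `P ∖ E` the left extended integrand is `f x ≠ 0` while the right one is `0` or `f' x ≠ f x`.
   So `[P, f] ≡ [E, f]` and `[P', f'] ≡ [E, f']`
   (`KZ.IntegralRep.of_sub_of_restrict_mem_relations`: domain additivity plus "null domains are
   relations"), and `[E, f] ≡ [E, f']` is the congruence lemma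
   `KZ.of_sub_of_mem_relations_of_eqOn`.
This is the pattern of `KZ.IsDominatedFamily.of_sub_of_mem_relations`
(`KZDominatedFamilyRelations.lean`), with step 1 added because a.e. equality of the EXTENDED
integrands does not force the domains to agree a.e. (they may differ where an integrand vanishes).

Sources: M. Kontsevich, D. Zagier, *Periods* (2001), §1.2, rule (1); J. Bochnak, M. Coste,
M.-F. Roy, *Real Algebraic Geometry* (1998), Thm. 2.2.1, Prop. 2.2.6 (Tarski–Seidenberg). Not here:
anything about limits of families (the route's cruxes); this file is the elementary first lemma.
-/

noncomputable section

open MeasureTheory Set Filter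

namespace Summit.KontsevichZagierPeriods.StandardParts

open Literature.NumberTheory.Transcendental Literature.NumberTheory.Transcendental.KZ
open Literature.ModelTheory.ExponentialFields (IsSemialgebraic)
open Summit.KontsevichZagierPeriods.KontsevichZagierPeriods.ReducedPeriodRingNegative
  (isSemialgebraic_sep_integrand_eq_zero isSemialgebraic_sep_integrand_ne_zero)

variable {n : ℕ}

/-- **Splitting off the zero set of the integrand.** For a representation `[σ, f]` with support
`P = {x ∈ σ | f x ≠ 0}`, `[σ, f] − [P, f] ∈ KZ.relations`: domain additivity
`σ = P ∪ {f = 0}` (disjoint pieces), the piece `[{x ∈ σ | f x = 0}, f]` being a relation since its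
integrand vanishes on its domain (`KZ.of_mem_relations_of_eqOn_zero`).
[Kontsevich–Zagier 2001, §1.2, rule (1)] [folklore] -/
theorem of_sub_of_restrict_ne_zero_mem_relations (r : IntegralRep n) :
    of r - of (r.restrict {x | x ∈ r.domain ∧ r.integrand x ≠ 0}
      (isSemialgebraic_sep_integrand_ne_zero r) (fun _ hx => hx.1)) ∈ relations := by
  set P : Set (Fin n → ℝ) := {x | x ∈ r.domain ∧ r.integrand x ≠ 0} with hP_def
  set Z : Set (Fin n → ℝ) := {x | x ∈ r.domain ∧ r.integrand x = 0} with hZ_def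
  have hP : IsSemialgebraic ℚ P := isSemialgebraic_sep_integrand_ne_zero r
  have hZ : IsSemialgebraic ℚ Z := isSemialgebraic_sep_integrand_eq_zero r
  have hPr : P ⊆ r.domain := fun _ hx => hx.1
  have hZr : Z ⊆ r.domain := fun _ hx => hx.1
  have hdom : r.domain = (r.restrict P hP hPr).domain ∪ (r.restrict Z hZ hZr).domain := by
    ext x
    simp only [IntegralRep.domain_restrict, mem_union, hP_def, hZ_def, mem_setOf_eq]
    by_cases hx : r.integrand x = 0 <;> simp [hx]
  have hnull : volume ((r.restrict P hP hPr).domain ∩ (r.restrict Z hZ hZr).domain) = 0 := by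
    have : (r.restrict P hP hPr).domain ∩ (r.restrict Z hZ hZr).domain = ∅ := by
      ext x
      simp only [IntegralRep.domain_restrict, hP_def, hZ_def, mem_inter_iff, mem_setOf_eq,
        mem_empty_iff_false, iff_false, not_and, and_imp]
      exact fun _ h _ => h
    rw [this, measure_empty]
  have hadd : of r - of (r.restrict P hP hPr) - of (r.restrict Z hZ hZr) ∈ domainAddRel :=
    ⟨n, r, r.restrict P hP hPr, r.restrict Z hZ hZr, hdom, hnull, fun _ _ => rfl, fun _ _ => rfl,
      rfl⟩
  have hN : of (r.restrict Z hZ hZr) ∈ relations :=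
    of_mem_relations_of_eqOn_zero _ fun x hx => hx.2
  have := relations.add_mem (domainAddRel_subset_relations hadd) hN
  simpa using this

/-- **A.e.-congruence of the Kontsevich–Zagier calculus (formal-group form).** If the integrands
of two representations `[σ, f]`, `[σ', f']` of the same dimension, extended by zero, agree almost
everywhere, then `[σ, f] − [σ', f'] ∈ KZ.relations`. Split off the zero sets
(`of_sub_of_restrict_ne_zero_mem_relations`); on the supports `P`, `P'` the equaliser
`E = {x ∈ P ∩ P' | f x = f' x}` is `ℚ`-semialgebraic (Tarski–Seidenberg) with `P ∖ E`, `P' ∖ E`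
null by hypothesis, so `[P, f] ≡ [E, f] ≡ [E, f'] ≡ [P', f']` by domain additivity, null domains
being relations, and congruence on a common domain.
[Kontsevich–Zagier 2001, §1.2, rule (1); BCR 1998, Thm. 2.2.1] [folklore] -/
theorem of_sub_of_mem_relations_of_indicator_ae_eq (r r' : IntegralRep n)
    (h : r.domain.indicator r.integrand =ᵐ[volume] r'.domain.indicator r'.integrand) :
    of r - of r' ∈ relations := by
  set P : Set (Fin n → ℝ) := {x | x ∈ r.domain ∧ r.integrand x ≠ 0} with hP_def
  set P' : Set (Fin n → ℝ) := {x | x ∈ r'.domain ∧ r'.integrand x ≠ 0} with hP'_def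
  have hP : IsSemialgebraic ℚ P := isSemialgebraic_sep_integrand_ne_zero r
  have hP' : IsSemialgebraic ℚ P' := isSemialgebraic_sep_integrand_ne_zero r'
  have hPr : P ⊆ r.domain := fun _ hx => hx.1
  have hP'r : P' ⊆ r'.domain := fun _ hx => hx.1
  set rP := r.restrict P hP hPr with hrP_def
  set rP' := r'.restrict P' hP' hP'r with hrP'_def
  have hI : IsSemialgebraic ℚ (P ∩ P') := hP.inter hP'
  set E : Set (Fin n → ℝ) := {x | x ∈ P ∩ P' ∧ r.integrand x = r'.integrand x} with hE_def
  have hE : IsSemialgebraic ℚ E :=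
    isSemialgebraic_sep_eq (rP.isSemialgebraicFunOn_integrand.mono inter_subset_left hI)
      (rP'.isSemialgebraicFunOn_integrand.mono inter_subset_right hI)
  have hEA : E ⊆ rP.domain := fun x hx => hx.1.1
  have hEB : E ⊆ rP'.domain := fun x hx => hx.1.2
  have hvolA : volume (rP.domain \ E) = 0 := by
    rw [measure_eq_zero_iff_ae_notMem]
    filter_upwards [h] with x hx hxm
    obtain ⟨⟨hxσ, hfx⟩, hxE⟩ := hxm
    rw [indicator_of_mem hxσ] at hx
    by_cases hxσ' : x ∈ r'.domain
    · rw [indicator_of_mem hxσ'] at hx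
      exact hxE ⟨⟨⟨hxσ, hfx⟩, hxσ', fun h0 => hfx (hx.trans h0)⟩, hx⟩
    · rw [indicator_of_notMem hxσ'] at hx
      exact hfx hx
  have hvolB : volume (rP'.domain \ E) = 0 := by
    rw [measure_eq_zero_iff_ae_notMem]
    filter_upwards [h] with x hx hxm
    obtain ⟨⟨hxσ', hfx'⟩, hxE⟩ := hxm
    rw [indicator_of_mem hxσ'] at hx
    by_cases hxσ : x ∈ r.domain
    · rw [indicator_of_mem hxσ] at hx
      exact hxE ⟨⟨⟨hxσ, fun h0 => hfx' (hx.symm.trans h0)⟩, hxσ', hfx'⟩, hx⟩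
    · rw [indicator_of_notMem hxσ] at hx
      exact hfx' hx.symm
  have h₁ : of rP - of (rP.restrict E hE hEA) ∈ relations :=
    rP.of_sub_of_restrict_mem_relations hE hEA hvolA
  have h₂ : of rP' - of (rP'.restrict E hE hEB) ∈ relations :=
    rP'.of_sub_of_restrict_mem_relations hE hEB hvolB
  have h₃ : of (rP.restrict E hE hEA) - of (rP'.restrict E hE hEB) ∈ relations :=
    of_sub_of_mem_relations_of_eqOn rfl fun x hx => hx.2
  have h₄ : of r - of rP ∈ relations := of_sub_of_restrict_ne_zero_mem_relations r
  have h₅ : of r' - of rP' ∈ relations := of_sub_of_restrict_ne_zero_mem_relations r'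
  have : of r - of r' = (of r - of rP) - (of r' - of rP') +
      ((of rP - of (rP.restrict E hE hEA)) - (of rP' - of (rP'.restrict E hE hEB)) +
        (of (rP.restrict E hE hEA) - of (rP'.restrict E hE hEB))) := by
    abel
  rw [this]
  exact relations.add_mem (relations.sub_mem h₄ h₅)
    (relations.add_mem (relations.sub_mem h₁ h₂) h₃)

/-- **Route StandardParts, item stmt-KontsevichZagierPeriods-3156 (`SpAeCongruence`).**
Representations of the same dimension whose extended-by-zero integrands agree almost everywhere
are KZ-equivalent: `1_σ f = 1_{σ'} f'` a.e. implies `KZ.Equivalent [σ, f] [σ', f']`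
(`of_sub_of_mem_relations_of_indicator_ae_eq`, read through the route's definition). Makes
`L¹`-endpoints of arcs of representations well defined modulo moves.
[Kontsevich–Zagier 2001, §1.2, rule (1); BCR 1998, Thm. 2.2.1] [folklore] -/
theorem SpAeCongruence_proof :
    Summit.KontsevichZagierPeriods.KontsevichZagierPeriods.Theses.StandardParts.SpAeCongruence := by
  unfold Summit.KontsevichZagierPeriods.KontsevichZagierPeriods.Theses.StandardParts.SpAeCongruence
  intro n r r' h
  exact of_sub_of_mem_relations_of_indicator_ae_eq r r' h

end Summit.KontsevichZagierPeriods.StandardParts
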